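import Summits.BirchSwinnertonDyer.BirchSwinnertonDyer.Theorems.SignedLowerHalvesSmallImageLowerHalfBothSignsRttD2SeqSemilocData
import Summits.BirchSwinnertonDyer.BirchSwinnertonDyer.Theorems.SignedLowerHalvesSmallImageLowerHalfBothSignsRttD2SeqJ3Junction
import HarnessLib

/-!
# Route `SignedLowerHalves`, crux L `SmallImageLowerHalfBothSigns` (stmt-BirchSwinnertonDyer-23599), line `rtt_w3` v24 — stub S3β (`stub_junctionPT_ns`), brick T2:
# THE SEMILOCALISATION `sloc_w : I.H →ₗ[Λ_𝒪] 𝐇¹_{Iw,w}` OF honda's JUNCTION MODULE INTO THE SEMILOCAL IWASAWA MODULE, and ★★★ `B′ = ⋂_{w∈S₀} ker sloc_w`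
# (the depleted junction carrier `strictCarrier I (strictLevel … S₀)` IS the kernel of the semilocalisation at `S₀`)

WIDTH seat `bsd-line-slh-p3-w3` g25 under LEAD `cruxlead-stmt-BirchSwinnertonDyer-23599` g13 (cell `bsd-ssimc`); helper `--supports stmt-BirchSwinnertonDyer-23599`
(design memo `Lines/rtt_w3-DESIGN-S3beta-w3-g25.md`, §1 (e), §2 T2). DEFINITIONS WITH BODIES (`kerProj`, `quotModuleCoeff`, `quotProj`, ★ `semilocMap`) + THEOREMS; no named fact, no
instance, no `sorry`. Sequel of T1-a/T1-b (`…SemilocLayer`, `…SemilocLevelOps`, `…SemilocData`). HONEST FRAMING: this is the first map of the compact five-term sequence behind S3β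
(`B′ ↪ I.H → ⊕_{w∈S₀K} Hloc_w → coker gX ↠ Y′`) together with its exactness at `I.H`; nothing about S3β, E2, crux L or BSD is proved; all remain OPEN and are proved for NO curve.

* §1 RIGIDITY of the semilocal datum: `proj n k (F • z) = F • proj n k z` through the forced level structure (Kaplansky §19 (a) along the `𝒪`-linear level embedding of
  `H ⧸ ker (proj n k)`, verbatim the one-variable proof of honda's `proj_smul_eq_cycLayer_smul`); `addMonoidHom_map_smul_of_proj`.
* §2 `semilocNK_smulΛ` — the semilocalisation of a level is `Λ_𝒪`-linear for the forced structures on both sides (`𝒪`-linear + intertwines `conj_γ − 1` with `R_γ − 1`).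
* §3 ★ `semilocMap hNP I L : I.H →ₗ[Λ_𝒪] L.H` (levelwise `semilocNK`, glued by (P3)/(P4); `Λ_𝒪`-linear by the two rigidities), `proj_semilocMap`, `semilocMap_eq_zero_iff`, uniqueness.
* §4 ★★★ `mem_strictCarrier_iff_forall_semilocMap_eq_zero` — `b ∈ strictCarrier I (strictLevel S κ θ′ P S₀) _ ↔ ∀ w ∈ S₀, semilocMap … (L w) b = 0`.
References: [Kaplansky1954] §19; [Kato2004Asterisque] §8.2, §17.13; [NeukirchSchmidtWingberg2008] (8.6.2)–(8.6.3); [Rubin2000] Thm. 1.7.3, App. B.3; [Lang1990] Ch. 5 §1.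
-/

set_option autoImplicit false
set_option linter.dupNamespace false -- D-0017: single-problem summit, the namespace repeats the problem name by design
noncomputable section

open scoped Classical PowerSeries
open NumberField IsDedekindDomain Field CategoryTheory Function

namespace Summit.BirchSwinnertonDyer.BirchSwinnertonDyer.Theorems.SmallImageRttD2Seq

open Literature.NumberTheory.EllipticCurves Literature.NumberTheory.GaloisRepresentations
  Literature.NumberTheory.ComplexMultiplication.EllipticUnits.JohnsonLeungKings2011
  Literature.Algebra.Module.LocallyNilpotent
  Summit.BirchSwinnertonDyer.BirchSwinnertonDyer.Theorems.SmallImageRttD2J1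
  Summit.BirchSwinnertonDyer.BirchSwinnertonDyer.Theorems.SmallImageRttD2J2

/-! ## §1. Rigidity of the pins of the semilocal datum -/

namespace SemilocIwasawaCohomologyDataO

section Rigidity

variable {K : Type} [Field K] [NumberField K] {p : ℕ} [Fact p.Prime] {S : Set (PadicAlgCl p)} {κ : ZpExtension K p} {γ : absoluteGaloisGroup K}
  {θ' : absoluteGaloisGroup K →ₜ* (padicCoeffIntegers S)ˣ} {P : Set (HeightOneSpectrum (𝓞 K))} {w : HeightOneSpectrum (𝓞 K)} {i : ℕ}
  (L : SemilocIwasawaCohomologyDataO S κ γ θ' P w i) (n k : ℕ)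

/-- **The kernel of `proj n k` as a `Λ_𝒪`-submodule** ((P8) packaged). [cite: Kato2004Asterisque, §8.2 (p. 180)] -/
def kerProj : Submodule (IwasawaAlgebraO S) L.H where
  carrier := {x | L.proj n k x = 0}
  zero_mem' := map_zero _
  add_mem' {x y} hx hy := by
    change L.proj n k (x + y) = 0
    rw [map_add, hx, hy, add_zero]
  smul_mem' f x hx := L.proj_smul_eq_zero n k f x hx

/-- Membership in `kerProj`. [folklore] -/
@[simp] theorem mem_kerProj_iff (x : L.H) : x ∈ L.kerProj n k ↔ L.proj n k x = 0 := Iff.rfl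

/-- The `𝒪`-structure of `H ⧸ ker (proj n k)` (restriction along `C : 𝒪 → 𝒪⟦T⟧`; activate with `letI`). [cite: Lang1990, Ch. 5 §1] -/
@[reducible] def quotModuleCoeff : Module (padicCoeffIntegers S) (L.H ⧸ L.kerProj n k) :=
  Module.compHom _ (PowerSeries.C : padicCoeffIntegers S →+* IwasawaAlgebraO S)

/-- **The level embedding `H ⧸ ker (proj n k) → Lloc_w(n,k)`, `𝒪`-linear** ((P7)). [cite: Kato2004Asterisque, §8.2 (p. 180)] -/
def quotProj :
    letI := L.quotModuleCoeff n k
    letI := semilocModuleO S κ θ' P w n k i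
    (L.H ⧸ L.kerProj n k) →ₗ[padicCoeffIntegers S] semilocCoh S κ θ' P w n k i := by
  letI := L.quotModuleCoeff n k
  letI := semilocModuleO S κ θ' P w n k i
  exact
    { toFun := QuotientAddGroup.lift (L.kerProj n k).toAddSubgroup (L.proj n k) fun x hx ↦ hx
      map_add' := fun x y ↦ map_add _ x y
      map_smul' := fun c x ↦ by
        obtain ⟨x, rfl⟩ := Submodule.Quotient.mk_surjective _ x
        change L.proj n k ((PowerSeries.C c : IwasawaAlgebraO S) • x) = semilocScalar S κ θ' P w n k i c (L.proj n k x)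
        exact L.proj_C_smul c n k x }

/-- `quotProj [x] = proj n k x`. [folklore] -/
theorem quotProj_mk (x : L.H) :
    (letI := L.quotModuleCoeff n k
     letI := semilocModuleO S κ θ' P w n k i
     L.quotProj n k (Submodule.Quotient.mk x)) = L.proj n k x := rfl

/-- The level embedding is injective. [folklore] -/
theorem quotProj_injective :
    letI := L.quotModuleCoeff n k
    letI := semilocModuleO S κ θ' P w n k i
    Function.Injective (L.quotProj n k) := by
  letI := L.quotModuleCoeff n k
  letI := semilocModuleO S κ θ' P w n k i
  intro x y hxy
  obtain ⟨x, rfl⟩ := Submodule.Quotient.mk_surjective _ x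
  obtain ⟨y, rfl⟩ := Submodule.Quotient.mk_surjective _ y
  rw [← sub_eq_zero, ← Submodule.Quotient.mk_sub, Submodule.Quotient.mk_eq_zero, mem_kerProj_iff, map_sub, sub_eq_zero]
  exact hxy

/-- ★★ **RIGIDITY OF THE PINS: `proj n k (F • x) = F • proj n k x`** for every `F ∈ Λ_𝒪`, the right-hand side through the forced level structure `semilocLayerModuleΛ`, for ANY semilocal
datum `L` (Kaplansky §19 (a) along the `𝒪`-linear level embedding of `H ⧸ ker (proj n k)`, on which `T` acts through the locally nilpotent `R_γ − 1`). [cite: Kaplansky1954, §19]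
[cite: Lang1990, Ch. 5 §1] [cite: Kato2004Asterisque, §8.2 (p. 180)] -/
theorem proj_smul_eq_layer_smul (F : IwasawaAlgebraO S) (x : L.H) :
    L.proj n k (F • x) = (letI := semilocLayerModuleΛ S κ γ θ' P w n k i; F • L.proj n k x) := by
  letI iC := L.quotModuleCoeff n k
  letI j0 := semilocModuleO S κ θ' P w n k i
  letI j2 := semilocLayerModuleΛ S κ γ θ' P w n k i
  obtain ⟨hC', hX'⟩ := semilocLayerModuleΛ_spec S κ γ θ' P w n k i
  let ψ : Module.End (padicCoeffIntegers S) (L.H ⧸ L.kerProj n k) :=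
    { toFun := fun v ↦ (PowerSeries.X : IwasawaAlgebraO S) • v
      map_add' := fun v v' ↦ smul_add _ v v'
      map_smul' := fun c v ↦ by
        change (PowerSeries.X : IwasawaAlgebraO S) • ((PowerSeries.C c : IwasawaAlgebraO S) • v) =
          (PowerSeries.C c : IwasawaAlgebraO S) • ((PowerSeries.X : IwasawaAlgebraO S) • v)
        rw [← mul_smul, mul_comm, mul_smul] }
  have hf : ∀ v, L.quotProj n k (ψ v) = semilocPsi S κ θ' P w n k i γ (L.quotProj n k v) := by
    intro v
    obtain ⟨x, rfl⟩ := Submodule.Quotient.mk_surjective _ v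
    change L.quotProj n k (Submodule.Quotient.mk ((PowerSeries.X : IwasawaAlgebraO S) • x)) = _
    rw [quotProj_mk, quotProj_mk L n k x, L.proj_X_smul, semilocPsi_apply]
  have hpow : ∀ (m : ℕ) (v), L.quotProj n k ((ψ ^ m) v) = (semilocPsi S κ θ' P w n k i γ ^ m) (L.quotProj n k v) := by
    intro m v
    induction m generalizing v with
    | zero => rfl
    | succ m ih => rw [pow_succ, pow_succ, Module.End.mul_apply, Module.End.mul_apply, ih, hf]
  have h : ∀ v, ∃ m : ℕ, (ψ ^ m) v = 0 := fun v ↦ by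
    obtain ⟨m, hm⟩ := semilocPsi_locallyNilpotent S κ γ θ' P w n k i (L.quotProj n k v)
    exact ⟨m, L.quotProj_injective n k (by rw [hpow, hm, map_zero])⟩
  have key := map_smul_of_comp_eq (R := padicCoeffIntegers S) (V := L.H ⧸ L.kerProj n k) (W := semilocCoh S κ θ' P w n k i) (T := ψ)
    (fun _ _ ↦ rfl) (fun _ ↦ rfl) hC' hX' h (L.quotProj n k) hf F (Submodule.Quotient.mk x)
  rw [← Submodule.Quotient.mk_smul, quotProj_mk, quotProj_mk] at key
  exact key

/-- ★ **An additive map between two semilocal data (same parameters) commuting with the projections is `Λ_𝒪`-linear** (rigidity on both sides + (P3)). [cite: Kaplansky1954, §19] -/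
theorem addMonoidHom_map_smul_of_proj (L' : SemilocIwasawaCohomologyDataO S κ γ θ' P w i) (e : L.H →+ L'.H)
    (he : ∀ (n k : ℕ) (x : L.H), L'.proj n k (e x) = L.proj n k x) (F : IwasawaAlgebraO S) (x : L.H) : e (F • x) = F • e x := by
  refine sub_eq_zero.mp (L'.proj_injective _ fun n k ↦ ?_)
  rw [map_sub, he, L.proj_smul_eq_layer_smul n k, L'.proj_smul_eq_layer_smul n k, he, sub_self]

end Rigidity

end SemilocIwasawaCohomologyDataO

/-! ## §2. The semilocalisation of a level is `Λ_𝒪`-linear for the forced structures -/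

section LevelLinear

variable {K : Type} [Field K] [NumberField K] {p : ℕ} [Fact p.Prime] (S : Set (PadicAlgCl p)) (κ : ZpExtension K p) (γ : absoluteGaloisGroup K)
  (θ' : absoluteGaloisGroup K →ₜ* (padicCoeffIntegers S)ˣ) (P : Set (HeightOneSpectrum (𝓞 K))) (w : HeightOneSpectrum (𝓞 K))

/-- **`sloc (F • y) = F • sloc y`** for `F ∈ Λ_𝒪` and the FORCED level structures (honda's `cycLayerModuleO` on `H¹(G_P(K_n), X_k)`, `semilocLayerModuleΛ` on `Lloc_w(n,k)`): `sloc` is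
`𝒪`-linear (`semilocNK_scalar`) and carries `conj_γ − 1` to `R_γ − 1` (`semilocNK_conj`), so Kaplansky §19 (a) applies. [cite: Kaplansky1954, §19] [cite: Lang1990, Ch. 5 §1] -/
theorem semilocNK_smulΛ (n k : ℕ) (F : IwasawaAlgebraO S) (y : cycLayerCohO S κ θ' P n k 1) :
    semilocNK S κ θ' P w n k (letI := cycLayerModuleO S κ γ θ' P (show 1 ≤ 2 by norm_num) n k; F • y) =
      (letI := semilocLayerModuleΛ S κ γ θ' P w n k 1; F • semilocNK S κ θ' P w n k y) := by
  letI i0 := levelModuleO S P θ' (κ.layerSubgroup n) k 1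
  letI i2 := cycLayerModuleO S κ γ θ' P (show 1 ≤ 2 by norm_num) n k
  letI j0 := semilocModuleO S κ θ' P w n k 1
  letI j2 := semilocLayerModuleΛ S κ γ θ' P w n k 1
  obtain ⟨hC, hX⟩ := cycLayerModuleO_spec S κ γ θ' P (show 1 ≤ 2 by norm_num) n k
  obtain ⟨hC', hX'⟩ := semilocLayerModuleΛ_spec S κ γ θ' P w n k 1
  let f : cycLayerCohO S κ θ' P n k 1 →ₗ[padicCoeffIntegers S] semilocCoh S κ θ' P w n k 1 :=
    { toFun := semilocNK S κ θ' P w n k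
      map_add' := map_add _
      map_smul' := fun c y ↦ by
        change semilocNK S κ θ' P w n k (cycLayerScalarO S κ θ' P n k 1 c y) = semilocScalar S κ θ' P w n k 1 c (semilocNK S κ θ' P w n k y)
        exact semilocNK_scalar S κ θ' P w n k c y }
  exact map_smul_of_comp_eq hC hX hC' hX' (cycLayerPsiO_locallyNilpotent S κ γ θ' P n k (show 1 ≤ 2 by norm_num)) f
    (fun y ↦ by
      change semilocNK S κ θ' P w n k (cycLayerConjO S κ θ' P n k 1 γ y - y) =
        semilocConj S κ θ' P w n k 1 γ (semilocNK S κ θ' P w n k y) - semilocNK S κ θ' P w n k y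
      rw [map_sub, semilocNK_conj]) F y

end LevelLinear

/-! ## §3. The semilocalisation `sloc_w : I.H →ₗ[Λ_𝒪] 𝐇¹_{Iw,w}` -/

section Map

variable {K : Type} [Field K] [NumberField K] {p : ℕ} [Fact p.Prime] {S : Set (PadicAlgCl p)} {κ : ZpExtension K p} {γ : absoluteGaloisGroup K}
  {θ' : absoluteGaloisGroup K →ₜ* (padicCoeffIntegers S)ˣ} {P : Set (HeightOneSpectrum (𝓞 K))} {w : HeightOneSpectrum (𝓞 K)}
  (hNP : ∀ n, ramificationSubgroup K P ≤ κ.layerSubgroup n)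
  (I : CycIwasawaCohomologyDataO S κ γ θ' P 1) (L : SemilocIwasawaCohomologyDataO S κ γ θ' P w 1)

/-- The levelwise semilocal family of a junction class: `(sloc_{w,n,k} (proj n k b))_{n,k}`. [cite: Rubin2000, App. B.3] -/
def semilocFamily (b : I.H) : ∀ n k : ℕ, semilocCoh S κ θ' P w n k 1 := fun n k ↦ semilocNK S κ θ' P w n k (I.proj n k b)

include hNP in
/-- The semilocal family is compatible with the corestrictions (`N_P ≤ U_m`). [cite: NeukirchSchmidtWingberg2008, I §5 Prop. 1.5.4] -/
theorem semilocFamily_cores (b : I.H) (n k : ℕ) :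
    semilocCores S κ θ' P w n k 1 (semilocFamily I b (n + 1) k) = semilocFamily I b n k := by
  unfold semilocFamily
  rw [← semilocNK_cores S κ θ' P w hNP n k, I.proj_cores]

/-- The semilocal family is compatible with the reductions. [cite: Kato2004Asterisque, §8.2 (p. 180)] -/
theorem semilocFamily_red (b : I.H) (n k : ℕ) :
    semilocRed S κ θ' P w n k 1 (semilocFamily I b n (k + 1)) = semilocFamily I b n k := by
  unfold semilocFamily
  rw [← semilocNK_red S κ θ' P w n k, I.proj_red]

include hNP in
/-- Existence of the lift of the semilocal family ((P4) of `L`). [cite: Kato2004Asterisque, §8.2 (p. 180)] -/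
theorem exists_lift_semilocFamily (b : I.H) : ∃ z : L.H, ∀ n k, L.proj n k z = semilocNK S κ θ' P w n k (I.proj n k b) :=
  L.proj_surjective (semilocFamily I b) (semilocFamily_cores hNP I b) (semilocFamily_red I b)

/-- ★ **THE SEMILOCALISATION `sloc_w : I.H →ₗ[Λ_𝒪] 𝐇¹_{Iw,w}`** of honda's junction module into the semilocal Iwasawa module at `w`: the unique map with
`proj n k (sloc_w b) = sloc_{w,n,k} (proj n k b)` for all `n, k` ((P4) lifts the compatible family, (P3) makes it unique and additive, the two rigidities + §2 make it `Λ_𝒪`-linear).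
Needs `N_P ≤ U_m` for all `m`. [cite: Rubin2000, Thm. 1.7.3, App. B.3] [cite: Kato2004Asterisque, §8.2, §17.13] [cite: NeukirchSchmidtWingberg2008, (8.6.2)] -/
def semilocMap : I.H →ₗ[IwasawaAlgebraO S] L.H where
  toFun b := Classical.choose (exists_lift_semilocFamily hNP I L b)
  map_add' b b' := by
    refine L.eq_of_forall_proj_eq fun n k ↦ ?_
    rw [Classical.choose_spec (exists_lift_semilocFamily hNP I L (b + b')) n k, (L.proj n k).map_add,
      Classical.choose_spec (exists_lift_semilocFamily hNP I L b) n k, Classical.choose_spec (exists_lift_semilocFamily hNP I L b') n k,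
      (I.proj n k).map_add, (semilocNK S κ θ' P w n k).map_add]
  map_smul' F b := by
    refine L.eq_of_forall_proj_eq fun n k ↦ ?_
    rw [Classical.choose_spec (exists_lift_semilocFamily hNP I L (F • b)) n k, RingHom.id_apply, L.proj_smul_eq_layer_smul n k,
      Classical.choose_spec (exists_lift_semilocFamily hNP I L b) n k, proj_smul_eq_cycLayer_smul (show 1 ≤ 2 by norm_num) I n k F b,
      semilocNK_smulΛ]

/-- ★ `proj n k (sloc_w b) = sloc_{w,n,k} (proj n k b)`. [cite: Rubin2000, App. B.3] -/
theorem proj_semilocMap (b : I.H) (n k : ℕ) : L.proj n k (semilocMap hNP I L b) = semilocNK S κ θ' P w n k (I.proj n k b) :=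
  Classical.choose_spec (exists_lift_semilocFamily hNP I L b) n k

/-- Uniqueness: any map with the levelwise property is `sloc_w`. [folklore] -/
theorem eq_semilocMap_of_proj (f : I.H → L.H) (hf : ∀ b n k, L.proj n k (f b) = semilocNK S κ θ' P w n k (I.proj n k b)) (b : I.H) :
    f b = semilocMap hNP I L b :=
  L.eq_of_forall_proj_eq fun n k ↦ by rw [hf, proj_semilocMap]

/-- ★★ `sloc_w b = 0 ↔` every semilocal level class `sloc_{w,n,k} (proj n k b)` vanishes ((P3)). [cite: NeukirchSchmidtWingberg2008, (8.6.2)–(8.6.3)] -/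
theorem semilocMap_eq_zero_iff (b : I.H) : semilocMap hNP I L b = 0 ↔ ∀ n k, semilocNK S κ θ' P w n k (I.proj n k b) = 0 := by
  constructor
  · intro h n k
    rw [← proj_semilocMap hNP I L b n k, h, map_zero]
  · intro h
    exact L.proj_injective _ fun n k ↦ by rw [proj_semilocMap, h n k]

end Map

/-! ## §4. The depleted junction carrier is the kernel of the semilocalisation at `S₀` -/

section Kernel

variable {K : Type} [Field K] [NumberField K] {p : ℕ} [Fact p.Prime] {S : Set (PadicAlgCl p)} {κ : ZpExtension K p} {γ : absoluteGaloisGroup K}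
  {θ' : absoluteGaloisGroup K →ₜ* (padicCoeffIntegers S)ˣ} {P : Set (HeightOneSpectrum (𝓞 K))}
  (hNP : ∀ n, ramificationSubgroup K P ≤ κ.layerSubgroup n) (S₀ : Set (HeightOneSpectrum (𝓞 K)))
  (I : CycIwasawaCohomologyDataO S κ γ θ' P 1) (L : ∀ w : HeightOneSpectrum (𝓞 K), SemilocIwasawaCohomologyDataO S κ γ θ' P w 1)
  (hStr : ∀ (n k : ℕ) (f : IwasawaAlgebraO S) (y : cycLayerCohO S κ θ' P n k 1), y ∈ strictLevel S κ θ' P S₀ n k →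
    (letI := cycLayerModuleO S κ γ θ' P (show 1 ≤ 2 by norm_num) n k; f • y) ∈ strictLevel S κ θ' P S₀ n k)

include hNP in
/-- ★★★ **`B′ = ⋂_{w ∈ S₀} ker sloc_w`**: a junction class lies in the depleted carrier `strictCarrier I (strictLevel S κ θ′ P S₀) _` (all localisations above `S₀` of all its level components
vanish) iff its semilocalisation vanishes at every `w ∈ S₀` — EXACTNESS AT `I.H` of the compact five-term sequence `B′ ↪ I.H → ⊕_{w∈S₀} 𝐇¹_{Iw,w} → …` behind S3β. (T1-a's
`mem_strictLevel_iff_forall_semilocNK_eq_zero` levelwise + (P3).) [cite: Rubin2000, Thm. 1.7.3, App. B.3] [cite: Kato2004Asterisque, §17.13] [cite: NeukirchSchmidtWingberg2008, (8.6.2)–(8.6.3)] -/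
theorem mem_strictCarrier_iff_forall_semilocMap_eq_zero (b : I.H) :
    b ∈ strictCarrier I (strictLevel S κ θ' P S₀) hStr ↔ ∀ w ∈ S₀, semilocMap hNP I (L w) b = 0 := by
  letI : ∀ n : ℕ, Fintype (absoluteGaloisGroup K ⧸ κ.layerSubgroup n) := fun n ↦ layerQuotFintype κ n
  haveI : ∀ n : ℕ, (κ.layerSubgroup n).FiniteIndex := fun n ↦ ⟨by rw [κ.index_layerSubgroup n]; exact pow_ne_zero _ (Fact.out : p.Prime).ne_zero⟩
  letI : ∀ n : ℕ, Fintype (↥(κ.layerSubgroup n) ⧸ (κ.layerSubgroup (n + 1)).subgroupOf (κ.layerSubgroup n)) := fun n ↦ Fintype.ofFinite _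
  rw [mem_strictCarrier_iff]
  simp only [mem_strictLevel_iff_forall_semilocNK_eq_zero S κ θ' P hNP S₀, semilocMap_eq_zero_iff]
  exact ⟨fun h w hw n k ↦ h n k w hw, fun h n k w hw ↦ h w hw n k⟩

end Kernel

end Summit.BirchSwinnertonDyer.BirchSwinnertonDyer.Theorems.SmallImageRttD2Seq

end
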